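import Mathlib
import HarnessLib
import Summits.HubbardSuperconductivity.HubbardSuperconductivity.Theorems.KLProgrammeC4aCoMovingJetsL1
import Summits.HubbardSuperconductivity.HubbardSuperconductivity.Theorems.KLProgrammeC4aJacobianCertJets

/-!
# Route `KLProgramme` — crux C4a: the tube tadpole-jet theorem WITH THE CERTIFIED JACOBIAN TABLE plugged in
# (`hJjet` discharged by `hJjet_cert`; only the vertex's co-moving `L¹(dϑ)` dominators (L3) and the polar-jet hypothesis remain)

Cell `gate-hubbard-kl`, lane hubbard-kl-c4a-1 (g3); helper for stub (C) `stub_twoLeg_curvature` of the engine-flow child `KLRegimeEngineV17F2`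
(stmt-HubbardSuperconductivity-20437); memo HOME/hubbard-kl-c4a-1/C4A-PLAN.md §12.1/§15.3/§16.  The (J-L¹) headline of …C4aCoMovingJetsL1,
`norm_iteratedDeriv_tubeTadpole_le_of_L1_unif`, carries the Jacobian-jet hypothesis `hJjet : ∀ ρ, |ρ| < r → ∀ i ≤ N, ‖∂ⁱ_s J(ρ,s)‖ ≤ G i`; …C4aJacobianCertJets
(p556869) discharges it with `G := klJacGCert T B.Dtmin A A₃ A₄ A₅` under the named numerical hypothesis `FreeBandPolarJets a b T` (k3c3-p3's certified
table `KlwjCertA/B`).  This file is the composition, in the two shapes the (A) assembly reads: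

* **`norm_iteratedDeriv_tubeTadpole_le_cert`** (`N = 4`, all four frame sizes `A, A₃, A₄, A₅`):
  `‖∂_θʲ ∫_{tube} f(e_K q)·V(Φ(0,θ), q) dq‖ ≤ (Σ_{i≤j} C(j,i)·klJacGCert T B.Dtmin A A₃ A₄ A₅ i·M_{j−i})·∫_{(−r,r)}‖f‖`, `j ≤ 4`;
* **`norm_iteratedDeriv_tubeTadpole_le_cert_two`** (`N = 2`, reads only `A, A₃`) — the `k ≤ 2` line of the curvature table, where the certified numbers matter
  (memo §12.3′/§15.4: `G₂c₀𝔪₂ + 2G₁c₁𝔪₂ + G₀c₂𝔪₂ + corner ≤ klC4aJetC2 2 = 2^4`).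

Pure composition; nothing is asserted about the Hubbard model.  References: BGM 2006 §2.4 (2.36), Lemma 2.1 (2.40) [cite: BenfattoGiulianiMastropietro2006].
-/

noncomputable section

namespace Summit.HubbardSuperconductivity.HubbardSuperconductivity.Theorems.C4a

set_option linter.dupNamespace false -- summit = problem name (single-conjunct summit), D-0017
set_option maxSynthPendingDepth 4 -- nested operator-norm instances (up to fifth Fréchet derivatives of the frame)

open Real Set MeasureTheory
open scoped ContDiff
open Literature.MathematicalPhysics.QuantumLattice Literature.MathematicalPhysics.QuantumLattice.BandSectorCounting
open Summit.HubbardSuperconductivity.HubbardSuperconductivity.Theorems.DispersionFlow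
open Summit.HubbardSuperconductivity.HubbardSuperconductivity.Theorems.PerturbedFermiCurve

section Tube

variable {a b : ℝ} (B : BandBounds a b) {K : TrigPolyC4v} {A : ℝ}
  (hA : ∀ p : Momentum, ∀ j ≤ 2, ‖iteratedFDeriv ℝ j (frameShift K) p‖ ≤ A) (hADt : 2 * A < B.Dtmin)
  {μ r : ℝ} (hr : 0 < r) (hlo : a < μ - r - A) (hhi : μ + r + A < b)
include B hA hADt hr hlo hhi

/-- **THE TUBE TADPOLE-JET THEOREM WITH THE CERTIFIED JACOBIAN TABLE (`N = 4`).**  Under `FreeBandPolarJets a b T`, frame sizes `A` (orders `≤ 2`),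
`A₃, A₄, A₅`, a smooth slice profile `f` supported in `(−r, r)`, a jointly smooth vertex `V` with co-moving `L¹(dϑ)` dominators `aV` (`CoMovingJetsL1 4`)
whose angular integrals are `≤ M_i` uniformly in the level: for `j ≤ 4` and every `θ`,
`‖∂_θʲ ∫_{tube} f(e_K q)·V(Φ(0,θ), q) dq‖ ≤ (Σ_{i≤j} C(j,i)·klJacGCert T B.Dtmin A A₃ A₄ A₅ i·M_{j−i})·∫_{(−r,r)}‖f‖`.
[cite: BenfattoGiulianiMastropietro2006, §2.4 (2.36)] -/
theorem norm_iteratedDeriv_tubeTadpole_le_cert {T : PolarJetTable} (hT : FreeBandPolarJets a b T) {A₃ A₄ A₅ : ℝ}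
    (hA₃ : ∀ p : Momentum, ‖iteratedFDeriv ℝ 3 (frameShift K) p‖ ≤ A₃)
    (hA₄ : ∀ p : Momentum, ‖iteratedFDeriv ℝ 4 (frameShift K) p‖ ≤ A₄)
    (hA₅ : ∀ p : Momentum, ‖iteratedFDeriv ℝ 5 (frameShift K) p‖ ≤ A₅)
    {f : ℝ → ℂ} (hf : ContDiff ℝ ∞ f) (hfsupp : tsupport f ⊆ Ioo (-r) r)
    {V : Momentum → Momentum → ℂ} (hV : ContDiff ℝ ∞ fun x : Momentum × Momentum => V x.1 x.2)
    {aV : ℕ → ℝ × ℝ → ℝ} (hVJ : CoMovingJetsL1 4 aV r μ K V)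
    {M : ℕ → ℝ} (hM : ∀ i ≤ 4, ∀ ρ ∈ Ioo (-r) r, ∫ ϑ in Ioc 0 (2 * π), aV i (ρ, ϑ) ≤ M i) {j : ℕ} (hj : j ≤ 4) (θ : ℝ) :
    ‖iteratedDeriv j (fun θ : ℝ =>
        ∫ q in {q : ℝ × ℝ | |q.1| < π ∧ |q.2| < π ∧ |frameLevel μ K (WithLp.toLp 2 ![q.1, q.2])| < r},
          f (frameLevel μ K (WithLp.toLp 2 ![q.1, q.2])) * V (levelPoint μ K 0 θ) (WithLp.toLp 2 ![q.1, q.2])) θ‖ ≤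
      (∑ i ∈ Finset.range (j + 1), (j.choose i : ℝ) * klJacGCert T B.Dtmin A A₃ A₄ A₅ i * M (j - i)) * ∫ ρ in Ioo (-r) r, ‖f ρ‖ :=
  norm_iteratedDeriv_tubeTadpole_le_of_L1_unif B hA hADt hr hlo hhi hf hfsupp (hJjet_cert B hA hADt hT hA₃ hA₄ hA₅ hlo hhi) hV hVJ hM hj θ

/-- **The `N = 2` form** (the `k ≤ 2` line of the curvature table): only the frame sizes `A` and `A₃` are read; `A₄, A₅` may be anything (the rows
`≤ 2` of `klJacGCert` do not depend on them, `klJacGCert_of_le_two`). [cite: BenfattoGiulianiMastropietro2006, §2.4 (2.36)] -/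
theorem norm_iteratedDeriv_tubeTadpole_le_cert_two {T : PolarJetTable} (hT : FreeBandPolarJets a b T) {A₃ : ℝ}
    (hA₃ : ∀ p : Momentum, ‖iteratedFDeriv ℝ 3 (frameShift K) p‖ ≤ A₃) (A₄ A₅ : ℝ)
    {f : ℝ → ℂ} (hf : ContDiff ℝ ∞ f) (hfsupp : tsupport f ⊆ Ioo (-r) r)
    {V : Momentum → Momentum → ℂ} (hV : ContDiff ℝ ∞ fun x : Momentum × Momentum => V x.1 x.2)
    {aV : ℕ → ℝ × ℝ → ℝ} (hVJ : CoMovingJetsL1 2 aV r μ K V)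
    {M : ℕ → ℝ} (hM : ∀ i ≤ 2, ∀ ρ ∈ Ioo (-r) r, ∫ ϑ in Ioc 0 (2 * π), aV i (ρ, ϑ) ≤ M i) {j : ℕ} (hj : j ≤ 2) (θ : ℝ) :
    ‖iteratedDeriv j (fun θ : ℝ =>
        ∫ q in {q : ℝ × ℝ | |q.1| < π ∧ |q.2| < π ∧ |frameLevel μ K (WithLp.toLp 2 ![q.1, q.2])| < r},
          f (frameLevel μ K (WithLp.toLp 2 ![q.1, q.2])) * V (levelPoint μ K 0 θ) (WithLp.toLp 2 ![q.1, q.2])) θ‖ ≤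
      (∑ i ∈ Finset.range (j + 1), (j.choose i : ℝ) * klJacGCert T B.Dtmin A A₃ A₄ A₅ i * M (j - i)) * ∫ ρ in Ioo (-r) r, ‖f ρ‖ := by
  have hJjet : ∀ ρ' : ℝ, |ρ'| < r → ∀ i ≤ 2, ∀ s : ℝ,
      ‖iteratedDeriv i (fun s : ℝ => levelChartJac μ K (ρ', s)) s‖ ≤ klJacGCert T B.Dtmin A A₃ A₄ A₅ i := by
    intro ρ' hρ' i hi s
    have h1 : a < μ + ρ' - A := by linarith [(abs_lt.1 hρ').1]
    have h2 : μ + ρ' + A < b := by linarith [(abs_lt.1 hρ').2]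
    exact norm_iteratedDeriv_levelChartJac_le_cert_two B hA hADt h1 h2 hT hA₃ A₄ A₅ hi s
  exact norm_iteratedDeriv_tubeTadpole_le_of_L1_unif B hA hADt hr hlo hhi hf hfsupp hJjet hV hVJ hM hj θ

end Tube

end Summit.HubbardSuperconductivity.HubbardSuperconductivity.Theorems.C4a

end
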